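import Literature.Probability.RandomPlanarGeometry.HexSAWStripSurfaceArchRadius
import Literature.Probability.RandomPlanarGeometry.HexSAWStripSurfaceCriticalArch
import Literature.Probability.RandomPlanarGeometry.HexSAWStripSurfaceLimits
import Mathlib.Topology.Algebra.InfiniteSum.Real
import HarnessLib

/-!
# The side class of the DCS strip is SUMMABLE in the length below the threshold:
# `A_{T,L}(x_c;y) + x_c^{2T−1} E_{T,L}(x_c;y) ≤ A_{T,L+1}(x_c;y)`, hence `Σ_L E_{T,L}(x_c;y) ≤ x_c^{1−2T} sup_L A_{T,L}(x_c;y) < ∞`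
# for every `y < y_T`, with the universal value `x_c^{1−2T}/cos(3π/8)` on `0 < y ≤ y* = 1 + √2`

Topic `Literature/Probability/RandomPlanarGeometry` (lane «pcv-sawmu», a-p2 g14; continues `HexSAWStripSurfaceArchRadius.lean` (a-p2 g11:
the injective surgery `HV.epsToArch` — an `ε`-walk of `S_{T,L}` continued down the boundary column beyond its cut into an ARCH of
`S_{T,L+1}`, `HV.epsToArch_mem`, `HV.epsToArch_injOn`, `HV.surfContacts_epsToArch`, `HV.mwLen_epsToArch`, and the comparison
`HV.mul_stripGFy_eps_le_alpha_succ : x_c^{2T−1} E_{T,L}(x_c;y) ≤ A_{T,L+1}(x_c;y)`), `HexSAWStripSurfaceLimits.lean`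
(`HV.stripGFy_alpha_mono_L`, `HV.stripGFy_alpha_le : A_{T,L}(x_c;y) ≤ 1/cos(3π/8)` for `0 < y < 1+√2`),
`HexSAWStripSurfaceCriticalArch.lean` (`HV.stripGFy_alpha_yStar_le`, the same at `y = y*`) and
`HexSAWStripSurfaceThresholdClasses.lean` (`HV.bddAbove_stripGFy_alpha_of_lt_stripYT`, `HV.stripBddSet_subset_alpha`).
Source: N. R. Beaton, M. Bousquet-Mélou, J. de Gier, H. Duminil-Copin, A. J. Guttmann, *The critical fugacity for surface adsorption
of self-avoiding walks on the honeycomb lattice is `1 + √2`*, Comm. Math. Phys. 326 (2014) 727–754, arXiv:1109.0358v5: proof of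
Proposition 9 (§4.3, p. 14) "hence `E_{T,L}(x_c; y)` is bounded by the tail of a convergent series and tends to `0` as `L → ∞`"
(for `y < y_T`; tree: `HV.stripELimZeroY_holds`, `HexSAWStripELimZeroY.lean`, by the printed tail argument), and §4.2 (p. 14) "the
numbers `A_{T,L}(x_c, y*)` … increase with `L` … remains bounded".  DCS12: H. Duminil-Copin, S. Smirnov, Ann. of Math. 175 (2012)
1653–1665, arXiv:1007.0575v2, §3 (the strip `S_{T,L}` and its boundary parts `α`, `β`, `ε`, `ε̄`).

## What is proved (namespace `Literature.Probability.RandomPlanarGeometry.SAW.HV`; `T ≥ 1`, `y ≥ 0`; standard axioms; no definition)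

* ★ `stripGFy_alpha_add_mul_eps_le_alpha_succ` — the INCREMENT form of the parent's comparison:
  `A_{T,L}(x_c;y) + x_c^{2T−1} · E_{T,L}(x_c;y) ≤ A_{T,L+1}(x_c;y)`.  The arches of `S_{T,L}` are arches of `S_{T,L+1}`, the surgered
  side exits of `S_{T,L}` are OTHER arches of `S_{T,L+1}` (they pass through the boundary column outside `S_{T,L}`), and the two
  families are disjoint; so the growth of the arch class in `L` dominates the side class.  `stripGFy_eps_le_mul_alpha_sub`:
  `E_{T,L} ≤ x_c^{1−2T} (A_{T,L+1} − A_{T,L})`.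
* `stripGFy_alpha_zero_add_mul_sum_eps_le`, `sum_stripGFy_eps_le` — telescoped: `Σ_{L<N} E_{T,L}(x_c;y) ≤ x_c^{1−2T} · A_{T,N}(x_c;y)`
  (every `y ≥ 0`, every `N`; at and above `y_T` this ties the partial sums of the side class to the arch divergence).
* ★★ `summable_stripGFy_eps_of_forall_alpha_le` (with the `tsum` bound), `summable_stripGFy_eps_of_bddAbove_alpha`,
  `summable_stripGFy_eps_of_lt_stripYT`, `summable_stripGFy_eps_of_mem_stripBddSet` — below the threshold (`0 ≤ y < y_T`, or `y ∈ stripBddSet T`) the side class is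
  SUMMABLE in `L`: `Σ_L E_{T,L}(x_c;y) ≤ x_c^{1−2T} · sup_L A_{T,L}(x_c;y) < ∞` — a quantitative form of the printed
  `E_{T,L}(x_c;y) → 0`, which is recovered as `tendsto_stripGFy_eps_zero_of_lt_stripYT` by a different proof (surgery instead of tails).
* ★★ `tsum_stripGFy_eps_le_of_lt_yStar`, `tsum_stripGFy_eps_yStar_le`, `stripGFy_eps_le_of_le_yStar` — the UNIVERSAL value on
  `0 < y ≤ y* = 1 + √2`: `Σ_L E_{T,L}(x_c; y) ≤ x_c^{1−2T} / cos(3π/8)` (identity (16): `A_{T,L}(x_c;y) ≤ 1/cos(3π/8)` there); at `T = 1`,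
  `y = y*` the constant `x_c^{−1}/cos(3π/8) = 2 + 2√2` is ATTAINED (tree `HexSAWStripSurfaceWidthOneProfile`: `E_{1,L} = 2q^{L+1}`, `q = 1/√2`).

Label: LANE LEMMA / NEW-IN-WRITING (modest, XS–S): print has `E_{T,L}(x_c;y) → 0` for `y < y_T` (Prop. 9, by tails); the
summability with the explicit constant and the increment inequality are the lane's, by the ε→arch surgery of the parent (itself «not
stated in print»).  NOT claimed: anything about `B_{T,L}` (an ε→BRIDGE surgery up the column would give the twin
`B_{T,L+1} − B_{T,L} ≳ E_{T,L}`; not here), a rate for `E_{T,L} → 0`, the order of divergence at `y_T`, numerics.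
Lane «pcv-sawmu», a-p2 g14, 2026-08-24.
-/

noncomputable section

open Finset Filter Topology

namespace Literature.Probability.RandomPlanarGeometry.SAW.HV

variable {T L : ℕ} {y : ℝ}

/-! ### The increment inequality -/

/-- A surgered side exit is NOT an arch of `S_{T,L}`: its inner list contains the head of the boundary column, which lies outside
`S_{T,L}`. [cite: DuminilCopinSmirnov2012, §3 (S_{T,L}, ε, ε̄); lane] -/
theorem epsToArch_not_mem_filter (hT : 1 ≤ T) {P : List HV} (hP : P ∈ epsWalks T L) :
    epsToArch L P ∉ (midWalks (stripV T L)).filter fun Q => IsAlphaDart (finalDart Q) := by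
  obtain ⟨l, hl, r, m, -, hmap, -, -, -, -, -, -⟩ := epsToArch_spec hT hP
  intro hmem
  have hV := (mem_midWalks_iff.1 (mem_filter.1 hmem).1).2.2.2.1
  rw [hmap, inner_cons_append] at hV
  have hhead : (exitX r L m false, ((m : ℕ) : ℤ), false) ∈ l ++ exitTail r L m :=
    List.mem_append_right _ (by rw [exitTail]; exact List.mem_cons_self)
  exact not_mem_stripV_of_mem_exitTail (T := T) (by rw [exitTail]; exact List.mem_cons_self) (hV _ hhead)

/-- ★ **`A_{T,L}(x_c;y) + x_c^{2T−1} · E_{T,L}(x_c;y) ≤ A_{T,L+1}(x_c;y)`** (`T ≥ 1`, `y ≥ 0`): the arches of `S_{T,L}` and the surgered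
side exits of `S_{T,L}` are two DISJOINT sub-families of the arches of `S_{T,L+1}`.
[cite: BeatonBousquetMelouDeGierDuminilCopinGuttmann2014, §4.2 (arXiv v5 p. 14: "A_{T,L} … increase with L") and Corollary 8 (p. 12); lane: increment form of the ε→arch comparison, not in print] -/
theorem stripGFy_alpha_add_mul_eps_le_alpha_succ (hT : 1 ≤ T) (L : ℕ) (hy : 0 ≤ y) :
    stripGFy T L IsAlphaDart y + hexCriticalFugacity ^ (2 * T - 1) * stripGFy T L (IsEpsDart L) y ≤
      stripGFy T (L + 1) IsAlphaDart y := by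
  classical
  obtain ⟨hx0, hx1⟩ := hexCriticalFugacity_pos_lt_one
  set S₁ := (midWalks (stripV T L)).filter fun Q => IsAlphaDart (finalDart Q) with hS₁
  set S₂ := (epsWalks T L).image (epsToArch L) with hS₂
  set w : List HV → ℝ := fun Q => hexCriticalFugacity ^ mwLen Q * y ^ surfContacts T Q with hw
  have hsub₁ : S₁ ⊆ (midWalks (stripV T (L + 1))).filter fun Q => IsAlphaDart (finalDart Q) :=
    filter_subset_filter _ (midWalks_mono (stripV_mono_L (Nat.le_succ L)))
  have hsub₂ : S₂ ⊆ (midWalks (stripV T (L + 1))).filter fun Q => IsAlphaDart (finalDart Q) := by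
    intro Q hQ
    obtain ⟨P, hP, rfl⟩ := mem_image.1 hQ
    exact epsToArch_mem hT hP
  have hdisj : Disjoint S₁ S₂ := by
    rw [Finset.disjoint_left]
    intro Q hQ₁ hQ₂
    obtain ⟨P, hP, rfl⟩ := mem_image.1 hQ₂
    exact epsToArch_not_mem_filter hT hP hQ₁
  have hA : stripGFy T L IsAlphaDart y = ∑ Q ∈ S₁, w Q := rfl
  have hE : hexCriticalFugacity ^ (2 * T - 1) * stripGFy T L (IsEpsDart L) y ≤ ∑ Q ∈ S₂, w Q := by
    calc hexCriticalFugacity ^ (2 * T - 1) * stripGFy T L (IsEpsDart L) y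
        = ∑ P ∈ epsWalks T L, hexCriticalFugacity ^ (2 * T - 1) * (hexCriticalFugacity ^ mwLen P * y ^ surfContacts T P) := by
          rw [stripGFy_eps_eq, mul_sum]
      _ ≤ ∑ P ∈ epsWalks T L, w (epsToArch L P) := by
          refine sum_le_sum fun P hP => ?_
          obtain ⟨m, hmT, hlen⟩ := mwLen_epsToArch hT hP
          simp only [hw]
          rw [surfContacts_epsToArch hT hP, hlen, ← mul_assoc, ← pow_add, add_comm (2 * T - 1)]
          exact mul_le_mul_of_nonneg_right (pow_le_pow_of_le_one hx0.le hx1.le (by omega)) (pow_nonneg hy _)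
      _ = ∑ Q ∈ S₂, w Q := by rw [hS₂, sum_image (epsToArch_injOn hT)]
  calc stripGFy T L IsAlphaDart y + hexCriticalFugacity ^ (2 * T - 1) * stripGFy T L (IsEpsDart L) y
      ≤ ∑ Q ∈ S₁, w Q + ∑ Q ∈ S₂, w Q := by rw [hA]; exact add_le_add le_rfl hE
    _ = ∑ Q ∈ S₁ ∪ S₂, w Q := (sum_union hdisj).symm
    _ ≤ stripGFy T (L + 1) IsAlphaDart y :=
        sum_le_sum_of_subset_of_nonneg (union_subset hsub₁ hsub₂) fun _ _ _ =>
          mul_nonneg (pow_nonneg hx0.le _) (pow_nonneg hy _)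

/-- `E_{T,L}(x_c;y) ≤ x_c^{−(2T−1)} · (A_{T,L+1}(x_c;y) − A_{T,L}(x_c;y))`. [cite: BeatonBousquetMelouDeGierDuminilCopinGuttmann2014, §4.2 (arXiv v5 p. 14); lane] -/
theorem stripGFy_eps_le_mul_alpha_sub (hT : 1 ≤ T) (L : ℕ) (hy : 0 ≤ y) :
    stripGFy T L (IsEpsDart L) y ≤
      (hexCriticalFugacity ^ (2 * T - 1))⁻¹ * (stripGFy T (L + 1) IsAlphaDart y - stripGFy T L IsAlphaDart y) := by
  have hx := pow_pos hexCriticalFugacity_pos_lt_one.1 (2 * T - 1)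
  rw [le_inv_mul_iff₀ hx]
  linarith [stripGFy_alpha_add_mul_eps_le_alpha_succ hT L hy]

/-! ### Telescoping: partial sums of the side class against the arch class -/

/-- `A_{T,0}(x_c;y) + x_c^{2T−1} · Σ_{L<N} E_{T,L}(x_c;y) ≤ A_{T,N}(x_c;y)`. [cite: BeatonBousquetMelouDeGierDuminilCopinGuttmann2014, §4.2 (arXiv v5 p. 14); lane] -/
theorem stripGFy_alpha_zero_add_mul_sum_eps_le (hT : 1 ≤ T) (N : ℕ) (hy : 0 ≤ y) :
    stripGFy T 0 IsAlphaDart y + hexCriticalFugacity ^ (2 * T - 1) * ∑ L ∈ Finset.range N, stripGFy T L (IsEpsDart L) y ≤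
      stripGFy T N IsAlphaDart y := by
  induction N with
  | zero => simp
  | succ N ih =>
    rw [sum_range_succ, mul_add, ← add_assoc]
    linarith [stripGFy_alpha_add_mul_eps_le_alpha_succ hT N hy]

/-- **`Σ_{L<N} E_{T,L}(x_c;y) ≤ x_c^{−(2T−1)} · A_{T,N}(x_c;y)`** for every `y ≥ 0` and every `N` (at and above `y_T` this ties the
partial sums of the side class to the arch divergence of `HexSAWStripSurfaceArchRadius`).
[cite: BeatonBousquetMelouDeGierDuminilCopinGuttmann2014, §4.2 (arXiv v5 p. 14) and Corollary 8 (p. 12); lane] -/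
theorem sum_stripGFy_eps_le (hT : 1 ≤ T) (N : ℕ) (hy : 0 ≤ y) :
    ∑ L ∈ Finset.range N, stripGFy T L (IsEpsDart L) y ≤
      (hexCriticalFugacity ^ (2 * T - 1))⁻¹ * stripGFy T N IsAlphaDart y := by
  have hx := pow_pos hexCriticalFugacity_pos_lt_one.1 (2 * T - 1)
  rw [le_inv_mul_iff₀ hx]
  linarith [stripGFy_alpha_zero_add_mul_sum_eps_le hT N hy, stripGFy_nonneg' T 0 IsAlphaDart hy]

/-! ### Summability below the threshold -/

/-- ★★ **Bounded arches ⇒ summable side class**: if `A_{T,L}(x_c;y) ≤ K` for all `L` then `Σ_L E_{T,L}(x_c;y)` converges and is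
`≤ x_c^{−(2T−1)} · K`. [cite: BeatonBousquetMelouDeGierDuminilCopinGuttmann2014, proof of Proposition 9 (§4.3, arXiv v5 p. 14: "E_{T,L}(x_c;y) … tends to 0"); lane: summable, explicit] -/
theorem summable_stripGFy_eps_of_forall_alpha_le (hT : 1 ≤ T) (hy : 0 ≤ y) {K : ℝ}
    (hK : ∀ L, stripGFy T L IsAlphaDart y ≤ K) :
    Summable (fun L => stripGFy T L (IsEpsDart L) y) ∧
      ∑' L, stripGFy T L (IsEpsDart L) y ≤ (hexCriticalFugacity ^ (2 * T - 1))⁻¹ * K := by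
  have hx := pow_pos hexCriticalFugacity_pos_lt_one.1 (2 * T - 1)
  have hnn : ∀ L, 0 ≤ stripGFy T L (IsEpsDart L) y := fun L => stripGFy_nonneg' T L (IsEpsDart L) hy
  have hbd : ∀ N, ∑ L ∈ Finset.range N, stripGFy T L (IsEpsDart L) y ≤ (hexCriticalFugacity ^ (2 * T - 1))⁻¹ * K :=
    fun N => (sum_stripGFy_eps_le hT N hy).trans (mul_le_mul_of_nonneg_left (hK N) (inv_nonneg.2 hx.le))
  exact ⟨summable_of_sum_range_le hnn hbd, Real.tsum_le_of_sum_range_le hnn hbd⟩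

/-- Bounded arches (as a `BddAbove`) ⇒ summable side class, with `Σ_L E_{T,L} ≤ x_c^{−(2T−1)} · sup_L A_{T,L}`.
[cite: BeatonBousquetMelouDeGierDuminilCopinGuttmann2014, proof of Proposition 9 (§4.3, arXiv v5 p. 14); lane] -/
theorem summable_stripGFy_eps_of_bddAbove_alpha (hT : 1 ≤ T) (hy : 0 ≤ y)
    (hb : BddAbove (Set.range fun L : ℕ => stripGFy T L IsAlphaDart y)) :
    Summable (fun L => stripGFy T L (IsEpsDart L) y) ∧
      ∑' L, stripGFy T L (IsEpsDart L) y ≤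
        (hexCriticalFugacity ^ (2 * T - 1))⁻¹ * ⨆ L : ℕ, stripGFy T L IsAlphaDart y :=
  summable_stripGFy_eps_of_forall_alpha_le hT hy fun L => le_ciSup hb L

/-- ★★ **Below the threshold the side class is summable**: `0 ≤ y < y_T ⇒ Σ_L E_{T,L}(x_c;y) < ∞` (`T ≥ 1`).
[cite: BeatonBousquetMelouDeGierDuminilCopinGuttmann2014, Corollary 8 (arXiv v5 p. 12) with Proposition 9 (p. 14 l. 16: y_T = the radius of convergence of A_T(x_c,·)) and its proof (p. 14); lane: summable, not only → 0] -/
theorem summable_stripGFy_eps_of_lt_stripYT (hT : 1 ≤ T) (hy : 0 ≤ y) (hlt : y < stripYT T) :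
    Summable (fun L => stripGFy T L (IsEpsDart L) y) :=
  (summable_stripGFy_eps_of_bddAbove_alpha hT hy (bddAbove_stripGFy_alpha_of_lt_stripYT hT hy hlt)).1

/-- On the whole boundedness set of the bridge class (`y ∈ stripBddSet T`, which contains `[0, y_T)` and, when the bridge class is
bounded at `y_T`, the threshold itself) the side class is summable. [cite: BeatonBousquetMelouDeGierDuminilCopinGuttmann2014, proof of Proposition 9 (§4.3, arXiv v5 p. 14); lane] -/
theorem summable_stripGFy_eps_of_mem_stripBddSet (hT : 1 ≤ T) (hmem : y ∈ stripBddSet T) :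
    Summable (fun L => stripGFy T L (IsEpsDart L) y) :=
  (summable_stripGFy_eps_of_bddAbove_alpha hT hmem.1 (stripBddSet_subset_alpha hT hmem).2).1

/-- The printed conclusion recovered by the surgery route: `E_{T,L}(x_c;y) → 0` for `0 ≤ y < y_T` (tree: `stripELimZeroY_holds`, by tails).
[cite: BeatonBousquetMelouDeGierDuminilCopinGuttmann2014, proof of Proposition 9 (§4.3, arXiv v5 p. 14: "tends to 0 as L → ∞")] -/
theorem tendsto_stripGFy_eps_zero_of_lt_stripYT (hT : 1 ≤ T) (hy : 0 ≤ y) (hlt : y < stripYT T) :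
    Tendsto (fun L => stripGFy T L (IsEpsDart L) y) atTop (𝓝 0) :=
  (summable_stripGFy_eps_of_lt_stripYT hT hy hlt).tendsto_atTop_zero

/-! ### The universal value on `0 < y ≤ y*` -/

/-- ★★ **`Σ_L E_{T,L}(x_c; y) ≤ x_c^{−(2T−1)} / cos(3π/8)` for every `0 < y < y* = 1 + √2`** (there `A_{T,L}(x_c;y) ≤ 1/cos(3π/8)` by
identity (16)). [cite: BeatonBousquetMelouDeGierDuminilCopinGuttmann2014, §4.1 eq. (16) (arXiv v5 p. 13) and §4.2 (p. 14); lane: explicit universal bound] -/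
theorem tsum_stripGFy_eps_le_of_lt_yStar (hT : 1 ≤ T) (hy : 0 < y) (hlt : y < 1 + Real.sqrt 2) :
    Summable (fun L => stripGFy T L (IsEpsDart L) y) ∧
      ∑' L, stripGFy T L (IsEpsDart L) y ≤ (hexCriticalFugacity ^ (2 * T - 1))⁻¹ * (1 / Real.cos (3 * Real.pi / 8)) :=
  summable_stripGFy_eps_of_forall_alpha_le hT hy.le fun _ => stripGFy_alpha_le hT hy hlt

/-- ★★ **… and at `y = y*` itself**: `Σ_L E_{T,L}(x_c; y*) ≤ x_c^{−(2T−1)} / cos(3π/8)`. [cite: BeatonBousquetMelouDeGierDuminilCopinGuttmann2014, §4.2 (arXiv v5 p. 14: "A_{T,L}(x_c; y*) remains bounded as L increases"); lane] -/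
theorem tsum_stripGFy_eps_yStar_le (hT : 1 ≤ T) :
    Summable (fun L => stripGFy T L (IsEpsDart L) yStar) ∧
      ∑' L, stripGFy T L (IsEpsDart L) yStar ≤ (hexCriticalFugacity ^ (2 * T - 1))⁻¹ * (1 / Real.cos (3 * Real.pi / 8)) :=
  summable_stripGFy_eps_of_forall_alpha_le hT yStar_pos.le fun L => stripGFy_alpha_yStar_le hT L

/-- Every single side-class value obeys the same universal bound on `0 < y ≤ y*`: `E_{T,L}(x_c;y) ≤ x_c^{−(2T−1)}/cos(3π/8)` (one term of a
nonnegative summable series). [cite: BeatonBousquetMelouDeGierDuminilCopinGuttmann2014, §4.2 (arXiv v5 p. 14); lane] -/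
theorem stripGFy_eps_le_of_le_yStar (hT : 1 ≤ T) (L : ℕ) (hy : 0 < y) (hle : y ≤ 1 + Real.sqrt 2) :
    stripGFy T L (IsEpsDart L) y ≤ (hexCriticalFugacity ^ (2 * T - 1))⁻¹ * (1 / Real.cos (3 * Real.pi / 8)) := by
  have hnn : ∀ L, 0 ≤ stripGFy T L (IsEpsDart L) y := fun L => stripGFy_nonneg' T L (IsEpsDart L) hy.le
  rcases hle.lt_or_eq with hlt | heq
  · obtain ⟨hs, ht⟩ := tsum_stripGFy_eps_le_of_lt_yStar hT hy hlt
    exact (hs.le_tsum L fun M _ => hnn M).trans ht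
  · have hyS : y = yStar := by rw [heq]; rfl
    subst hyS
    obtain ⟨hs, ht⟩ := tsum_stripGFy_eps_yStar_le hT
    exact (hs.le_tsum L fun M _ => hnn M).trans ht

end Literature.Probability.RandomPlanarGeometry.SAW.HV
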